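import Summits.RiemannHypothesis.RiemannHypothesis.Theses.WeilComb
import Literature.NumberTheory.LFunctions.WeilExplicit
import Literature.NumberTheory.LFunctions.WeilMellinBounds
import Literature.NumberTheory.LFunctions.WeilArchimedeanMoments
import Literature.Analysis.SpecialFunctions.DigammaVerticalSeries
import Literature.NumberTheory.LFunctions.RosserSchoenfeldMertensFirst
import Literature.NumberTheory.LFunctions.MertensFirstChainSound
import Mathlib.NumberTheory.ArithmeticFunction.VonMangoldt

/-!
# Sketch — helper-lemma statements for `stub_windowCore` (ideator k1, FAMILY 1: recognise & import)
Elaboration-only sanity file (every proof is `sorry`); the statements are the proposals of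
`STUB-IDEAS-stub_windowCore-1.md`.
-/

noncomputable section

set_option linter.dupNamespace false

open scoped BigOperators ComplexConjugate
open Complex MeasureTheory

namespace Summit.RiemannHypothesis.RiemannHypothesis.Theorems.WeilCombBohrFejer.IdeasK1

open Literature.NumberTheory.LFunctions
open Literature.Analysis.SpecialFunctions (reDigammaQuarter)

/-- the dilated bump `φ_ε` -/
def phiE (ε : ℝ) : ℝ → ℂ := fun t : ℝ => (ε : ℂ)⁻¹ * ((expNegInvGlue (1 - (t / ε) ^ 2) : ℝ) : ℂ)

/-- the comb `g_a = Σ_{m ≤ M} a_m φ_ε(· − log m)` (literally the route's expression) -/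
def comb (ε : ℝ) (M : ℕ) (a : ℕ → ℂ) : ℝ → ℂ := fun x : ℝ => ∑ m ∈ Finset.Icc 1 M,
  a m * ((ε : ℂ)⁻¹ * ((expNegInvGlue (1 - ((x - Real.log (m : ℝ)) / ε) ^ 2) : ℝ) : ℂ))

/-- the comb symbol `w_ε(x) = W(τ_x ψ_ε)` (Gram kernel, `stub_gram`) -/
def wsym (ε x : ℝ) : ℂ :=
  weilFunctional (weilTranslate (weilConv (phiE ε) (weilReflect (phiE ε))) x)

/-- the Perron ray `û_m = m^{-1/2}` -/
def perron (m : ℕ) : ℂ := ((Real.sqrt (m : ℝ) : ℝ) : ℂ)⁻¹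

/-- **L1 (one-sided Mertens reduction).** Only an UPPER bound `ψ₁(y) ≤ log y − γ + η(y)` on
`ψ₁(y) = Σ_{n ≤ y} Λ(n)/n` is load-bearing: plugged into the landed energy normal form
`weilQuadratic_comb_re_window_energyForm` it gives a lower bound for `Re Q` on every window cell. -/
theorem L1_window_energyForm_ge_of_psiOne_le (η : ℕ → ℝ)
    (hη : ∀ y : ℕ, 1 ≤ y →
      ∑ n ∈ Finset.Icc 1 y, (ArithmeticFunction.vonMangoldt n : ℝ) / n ≤
        Real.log y - Real.eulerMascheroniConstant + η y) :
    ∀ ε : ℝ, 0 < ε → ∀ (M : ℕ) (a : ℕ → ℂ), 1 ≤ M → 2 * ε * ((M : ℝ) + 1) ≤ 1 →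
      2 * (∫ u : ℝ, expNegInvGlue (1 - u ^ 2) * Real.cosh (ε * u / 2)) ^ 2 *
          ((∑ m ∈ Finset.Icc 1 M, a m * ((Real.sqrt (m : ℝ) : ℝ) : ℂ)⁻¹) *
            conj (∑ m ∈ Finset.Icc 1 M, a m * ((Real.sqrt (m : ℝ) : ℝ) : ℂ))).re -
        ε⁻¹ * weilNorm2Sq (fun u : ℝ => ((expNegInvGlue (1 - u ^ 2) : ℝ) : ℂ)) *
          ((∑ m ∈ Finset.Icc 1 M, ‖a m‖ ^ 2 *
              (Real.log M - Real.eulerMascheroniConstant + η (M / m))) -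
            ∑ m ∈ Finset.Icc 1 M, ∑ n ∈ Finset.Icc 1 (M / m),
              (ArithmeticFunction.vonMangoldt n : ℝ) * ‖a (n * m) - ((Real.sqrt n : ℂ))⁻¹ * a m‖ ^ 2) +
        (1 / (2 * Real.pi) * (∫ u : ℝ, ‖weilMellin (comb ε M a) (1 / 2 + u * I)‖ ^ 2 *
            (reDigammaQuarter u - reDigammaQuarter 0)) +
          (reDigammaQuarter 0 - Real.log Real.pi) *
            (ε⁻¹ * weilNorm2Sq (fun u : ℝ => ((expNegInvGlue (1 - u ^ 2) : ℝ) : ℂ)) *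
              ∑ m ∈ Finset.Icc 1 M, ‖a m‖ ^ 2))
      ≤ (weilQuadratic (comb ε M a)).re := by
  sorry

/-- **L2 (import RS62 (3.22) ⇒ ψ₁ upper bound with the γ).** `Σ_{n≤x} Λ(n)/n = Σ_{p≤x} log p/p + Σ_{p^k ≤ x, k ≥ 2}`
and the second sum is `≤ Σ_p log p/(p(p−1)) = −γ − E` (definition of `rosserSchoenfeldE`). -/
theorem L2_sum_vonMangoldt_div_lt_of_RS322 (h : RosserSchoenfeld1962_eq_3_22) :
    ∀ x : ℝ, 319 ≤ x →
      ∑ n ∈ Finset.Icc 1 ⌊x⌋₊, (ArithmeticFunction.vonMangoldt n : ℝ) / n <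
        Real.log x - Real.eulerMascheroniConstant + 1 / (2 * Real.log x) := by
  sorry

/-- **L3 (the kernel-certified range, hypothesis-free).** From the finished Mertens chain
(`MertensFirstChain.eq_3_22_of_inv` + `run2`, primes `≤ 442439`) and `E ≥ −ELO/2⁸⁰`. -/
theorem L3_sum_vonMangoldt_div_lt_certified :
    ∀ x : ℝ, 319 ≤ x → x ≤ 442439 →
      ∑ n ∈ Finset.Icc 1 ⌊x⌋₊, (ArithmeticFunction.vonMangoldt n : ℝ) / n <
        Real.log x - Real.eulerMascheroniConstant + 1 / (2 * Real.log x) := by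
  sorry

/-- **L4 (Perron is an exact eigenvector of Helson-minus-potential, row by row).** Row `m` of the
symmetrised Helson matrix applied to `û`: down-edges `n ∣ m` plus up-edges `n ≤ M/m` give
`û_m (log m + ψ₁(M/m))`; hence the Helson part of the Temple residual is the explicit variance
`Σ_m (1/m)(log m + ψ₁(M/m) − c)²`. -/
theorem L4_helson_perron_row (M m : ℕ) (hm : m ∈ Finset.Icc 1 M) :
    ∑ n ∈ m.divisors, (ArithmeticFunction.vonMangoldt n : ℝ) / Real.sqrt n *
        (Real.sqrt (((m / n : ℕ) : ℝ)))⁻¹ +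
      ∑ n ∈ Finset.Icc 1 (M / m), (ArithmeticFunction.vonMangoldt n : ℝ) / Real.sqrt n *
        (Real.sqrt (((n * m : ℕ) : ℝ)))⁻¹ =
      (Real.sqrt (m : ℝ))⁻¹ *
        (Real.log m + ∑ n ∈ Finset.Icc 1 (M / m), (ArithmeticFunction.vonMangoldt n : ℝ) / n) := by
  sorry

/-- **L5 (Temple's inequality instantiated on the comb Gram form with the Perron pivot).**
`temple_inner` (landed, abstract) on `V = EuclideanSpace ℂ (Fin M)` with `K` = the Gram operator of
`stub_gram` (real symmetric symbol, p93312): data `μ` (Perron Rayleigh quotient), `r2` (residual bound),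
`κ` (coercivity on `û^⊥`) ⟹ `λ_min ≥ μ − r2/(κ − μ)`. -/
theorem L5_temple_comb (ε : ℝ) (hε : 0 < ε) (M : ℕ) (hM : 1 ≤ M) {μ κ r2 : ℝ} (hμκ : μ < κ)
    (hμ : (weilQuadratic (comb ε M perron)).re = μ * ∑ m ∈ Finset.Icc 1 M, (1 : ℝ) / m)
    (hr : ∑ m ∈ Finset.Icc 1 M, ‖(∑ m' ∈ Finset.Icc 1 M, wsym ε (Real.log (m : ℝ) - Real.log (m' : ℝ)) *
        perron m') - (μ : ℂ) * perron m‖ ^ 2 ≤ r2 * ∑ m ∈ Finset.Icc 1 M, (1 : ℝ) / m)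
    (hκ : ∀ b : ℕ → ℂ, ∑ m ∈ Finset.Icc 1 M, b m * conj (perron m) = 0 →
      κ * ∑ m ∈ Finset.Icc 1 M, ‖b m‖ ^ 2 ≤ (weilQuadratic (comb ε M b)).re) :
    ∀ a : ℕ → ℂ, (μ - r2 / (κ - μ)) * ∑ m ∈ Finset.Icc 1 M, ‖a m‖ ^ 2 ≤
      (weilQuadratic (comb ε M a)).re := by
  sorry

/-- **L6 (the coercivity target on `û^⊥`, top cells; NOT one cycle — the analytic heart).**
Numerically `κ_⊥ ≈ 0.5…0.62` (siege k8); `κ₀ = 1/4` is what the assembly needs. -/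
def PerpCoercivityTopCells (κ₀ : ℝ) : Prop :=
  ∀ ε : ℝ, 0 < ε → ∀ (M : ℕ) (b : ℕ → ℂ), 2 ≤ M → 2 * ε * ((M : ℝ) + 1) ≤ 1 →
    1 < 2 * ε * ((M : ℝ) + 2) → ∑ m ∈ Finset.Icc 1 M, b m * conj (perron m) = 0 →
    κ₀ * (ε⁻¹ * weilNorm2Sq (fun u : ℝ => ((expNegInvGlue (1 - u ^ 2) : ℝ) : ℂ))) *
        ∑ m ∈ Finset.Icc 1 M, ‖b m‖ ^ 2 ≤ (weilQuadratic (comb ε M b)).re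

/-- **L7 (effective one-sided Mertens tail — THE literature debt; named-fact shape).** -/
def PsiOneUpperTail (Y₀ : ℝ) (η : ℝ → ℝ) : Prop :=
  ∀ x : ℝ, Y₀ ≤ x →
    ∑ n ∈ Finset.Icc 1 ⌊x⌋₊, (ArithmeticFunction.vonMangoldt n : ℝ) / n ≤
      Real.log x - Real.eulerMascheroniConstant + η x

/-- sanity: the RS-shaped tail is the instance the assembly wants beyond the certified range. -/
example : PsiOneUpperTail 442439 (fun x => 1 / (2 * Real.log x)) →
    ∀ x : ℝ, 442439 ≤ x →
      ∑ n ∈ Finset.Icc 1 ⌊x⌋₊, (ArithmeticFunction.vonMangoldt n : ℝ) / n ≤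
        Real.log x - Real.eulerMascheroniConstant + 1 / (2 * Real.log x) :=
  fun h x hx => h x hx

end Summit.RiemannHypothesis.RiemannHypothesis.Theorems.WeilCombBohrFejer.IdeasK1

end
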